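import Summits.MatrixMultiplication.MatrixMultiplication.Theorems.ObstructionDescentUniversalOccurrenceTwoRectangleTwistLemmas

set_option linter.dupNamespace false
set_option autoImplicit false

/-!
# Universal occurrence — two rectangles: the SIGN LAW of the twisted storey design (decomp-mm · lens 3 · gen 46, K36-B)

Route `route-MatrixMultiplication-ObstructionDescent` (sub-problem `MatrixMultiplication`, `ω(ℂ) = 2`); SUPPORT for the crux
`NoOccurrenceObstruction` (`P_O`, item `stmt-MatrixMultiplication-29040`), universal-occurrence programme.  No `def`, no `sorry`.

The storey designs `D″(N)` (`…TwoRectangleThreeThreeOne`) pair the crossed lifts `x = φ ∘ ι`, `y = ψ ∘ ι` of a word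
`ι : [2N] → [N+2]` (`φ(N) = ψ(N+1) = 0`, `φ(N+1) = ψ(N) = 1`, identity below `N`) with the block sign `ζ_e` on the first leg
and the TWISTED block sign `ζ_e(y ∘ κ)` on the second, `κ = (A B)(C D)` the double cross exchanging the two blocks at two
slots `h₁ ≠ h₂`.  **Sign law** (`twist_blockSign_mul`): if the letters `N`, `N+1` occur exactly once in `ι` (at `p_N`, `p_M`)
and both block signs are non-zero, then
`ζ_e(x) · ζ_e(y ∘ κ) = +1` if `p_N, p_M` lie in different blocks AND `κ p_N, κ p_M` lie in different blocks, and `= -1` otherwise.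
Proof: `y = x ∘ (p_N p_M)` (`liftPair_second_eq`); same block ⇒ one transposition and `ζ_e(u ∘ κ) = ζ_e(u)`
(`wordBlockSign_comp_doubleCross`); separated but joined by `κ` ⇒ conjugate the transposition through `κ`; separated twice ⇒
the positions of `N, N+1` or of their partners `0, 1` are crossed by `κ` and one of the three value patterns of
`…TwoRectangleTwistLemmas` §4 applies.  §1 collects the letter values of the lifts and two block-word facts, §2 the intrinsic
description of a double cross (it preserves slots and flips the block exactly at its two slots), which identifies `κ` with the
double cross through any of its cells.

[cite: BurgisserIkenmeyer2011, Thm. 4.4, Lemma 6.1] [cite: BurgisserIkenmeyer2017, §5, Thm. 5.9 (proof of (2)), Thm. 5.13 (proof)]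
-/

noncomputable section

open scoped BigOperators

namespace Summit.MatrixMultiplication.MatrixMultiplication.Theorems.ObstructionCalculus

open Literature.Computability.AlgebraicComplexity
open Literature.NumberTheory.DiophantineGeometry (Word)

/-! ### §1 Letter values of the crossed lifts; block-word facts -/

/-- Values `0` and `1` of the first lift `φ` (`φ(N) = 0`, `φ(N+1) = 1`). [this node] -/
theorem liftφ_val {N : ℕ} {φ : Fin (N + 2) → Fin N}
    (hφv : ∀ r, ((φ r : Fin N) : ℕ) = if (r : ℕ) < N then (r : ℕ) else (r : ℕ) - N) (h2N : 2 ≤ N) (r : Fin (N + 2)) :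
    (((φ r : Fin N) : ℕ) = 0 ↔ ((r : ℕ) = 0 ∨ (r : ℕ) = N)) ∧
      (((φ r : Fin N) : ℕ) = 1 ↔ ((r : ℕ) = 1 ∨ (r : ℕ) = N + 1)) := by
  have hr := r.2
  rw [hφv]
  split_ifs with h <;> omega

/-- **The second lift is the first with the letters `N`, `N+1` exchanged**: `ψ ∘ ι = (φ ∘ ι) ∘ (p_N p_M)` when `N`, `N+1`
occur in `ι` only at `p_N`, `p_M`. [this node] -/
theorem liftPair_second_eq {N : ℕ} {φ ψ : Fin (N + 2) → Fin N}
    (hφv : ∀ r, ((φ r : Fin N) : ℕ) = if (r : ℕ) < N then (r : ℕ) else (r : ℕ) - N)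
    (hψv : ∀ r, ((ψ r : Fin N) : ℕ) = if (r : ℕ) < N then (r : ℕ) else N + 1 - (r : ℕ))
    {ι : Fin (N * 2) → Fin (N + 2)} {pN pM : Fin (N * 2)}
    (hpN : ((ι pN : Fin (N + 2)) : ℕ) = N) (hpM : ((ι pM : Fin (N + 2)) : ℕ) = N + 1)
    (hrest : ∀ q, q ≠ pN → q ≠ pM → ((ι q : Fin (N + 2)) : ℕ) < N) :
    ψ ∘ ι = (φ ∘ ι) ∘ ⇑(Equiv.swap pN pM) := by
  funext q
  simp only [Function.comp_apply]
  apply Fin.ext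
  rw [hψv, hφv]
  by_cases hqN : q = pN
  · subst hqN
    rw [Equiv.swap_apply_left, hpN, hpM]
    split_ifs <;> omega
  by_cases hqM : q = pM
  · subst hqM
    rw [Equiv.swap_apply_right, hpN, hpM]
    split_ifs <;> omega
  rw [Equiv.swap_apply_of_ne_of_ne hqN hqM, if_pos (hrest q hqN hqM), if_pos (hrest q hqN hqM)]

/-- A block-bijective word separates positions of the same block. [folklore] -/
theorem eq_of_wordBlockSign_ne_zero {D δ N : ℕ} (e : Fin D ≃ Fin δ × Fin N) {u : Word N D}
    (hu : wordBlockSign ℂ e u ≠ 0) {q q' : Fin D} (hblk : (e q).1 = (e q').1) (huq : u q = u q') : q = q' := by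
  have hinj := (bijective_of_wordBlockSign_ne_zero e hu (e q).1).1
  have h1 : (fun j => u (e.symm ((e q).1, j))) (e q).2 = (fun j => u (e.symm ((e q).1, j))) (e q').2 := by
    show u (e.symm ((e q).1, (e q).2)) = u (e.symm ((e q).1, (e q').2))
    rw [Prod.mk.eta, Equiv.symm_apply_apply, hblk, Prod.mk.eta, Equiv.symm_apply_apply]
    exact huq
  exact e.injective (Prod.ext hblk (hinj h1))

/-- In `Fin 2`, two elements different from a third are equal. [folklore] -/
theorem fin_two_eq_of_ne_of_ne {a b c : Fin 2} (ha : a ≠ c) (hb : b ≠ c) : a = b := by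
  revert a b c; decide

/-! ### §2 The double cross, intrinsically -/

section DoubleCross

variable {D N : ℕ} (e : Fin D ≃ Fin 2 × Fin N) {b b' : Fin 2} {s s' : Fin N} {A B C D' : Fin D}

/-- **A double cross keeps the slot and flips the block exactly at its two slots.** [this node] -/
theorem doubleCross_spec (hbb' : b ≠ b') (hss' : s ≠ s') (hA : e A = (b, s)) (hB : e B = (b', s)) (hC : e C = (b, s'))
    (hD : e D' = (b', s')) (q : Fin D) :
    (e ((Equiv.swap A B * Equiv.swap C D') q)).2 = (e q).2 ∧
      ((e ((Equiv.swap A B * Equiv.swap C D') q)).1 = (e q).1 ↔ ((e q).2 ≠ s ∧ (e q).2 ≠ s')) := by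
  obtain ⟨hκA, hκB, hκC, hκD, hκq⟩ := doubleCross_apply e hbb' hss' hA hB hC hD
  obtain ⟨hsA, hsB, hsC, hsD⟩ := doubleCross_symm_apply e hA hB hC hD
  have hother : ∀ c : Fin 2, c = b ∨ c = b' := by
    have : ∀ b b' c : Fin 2, b ≠ b' → c = b ∨ c = b' := by decide
    exact fun c => this b b' c hbb'
  by_cases hqA : q = A
  · rw [hqA, hκA, hB, hA]
    exact ⟨rfl, ⟨fun h => absurd h hbb'.symm, fun h => absurd rfl h.1⟩⟩
  by_cases hqB : q = B
  · rw [hqB, hκB, hA, hB]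
    exact ⟨rfl, ⟨fun h => absurd h hbb', fun h => absurd rfl h.1⟩⟩
  by_cases hqC : q = C
  · rw [hqC, hκC, hD, hC]
    exact ⟨rfl, ⟨fun h => absurd h hbb'.symm, fun h => absurd rfl h.2⟩⟩
  by_cases hqD : q = D'
  · rw [hqD, hκD, hC, hD]
    exact ⟨rfl, ⟨fun h => absurd h hbb', fun h => absurd rfl h.2⟩⟩
  rw [hκq q hqA hqB hqC hqD]
  refine ⟨rfl, ⟨fun _ => ⟨fun hs => ?_, fun hs => ?_⟩, fun _ => rfl⟩⟩
  · rcases hother (e q).1 with hb | hb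
    · exact hqA (e.injective (by rw [hA]; exact Prod.ext hb hs))
    · exact hqB (e.injective (by rw [hB]; exact Prod.ext hb hs))
  · rcases hother (e q).1 with hb | hb
    · exact hqC (e.injective (by rw [hC]; exact Prod.ext hb hs))
    · exact hqD (e.injective (by rw [hD]; exact Prod.ext hb hs))

/-- A double cross is an involution. [folklore] -/
theorem doubleCross_apply_apply (hbb' : b ≠ b') (hss' : s ≠ s') (hA : e A = (b, s)) (hB : e B = (b', s))
    (hC : e C = (b, s')) (hD : e D' = (b', s')) (q : Fin D) :
    (Equiv.swap A B * Equiv.swap C D') ((Equiv.swap A B * Equiv.swap C D') q) = q := by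
  obtain ⟨hκA, hκB, hκC, hκD, hκq⟩ := doubleCross_apply e hbb' hss' hA hB hC hD
  by_cases hqA : q = A
  · rw [hqA, hκA, hκB]
  by_cases hqB : q = B
  · rw [hqB, hκB, hκA]
  by_cases hqC : q = C
  · rw [hqC, hκC, hκD]
  by_cases hqD : q = D'
  · rw [hqD, hκD, hκC]
  rw [hκq q hqA hqB hqC hqD, hκq q hqA hqB hqC hqD]

/-- **Uniqueness**: two permutations that keep slots and flip the block on the same set of slots are equal. [this node] -/
theorem perm_eq_of_blockSpec {κ₁ κ₂ : Equiv.Perm (Fin D)} {P₁ P₂ : Fin N → Prop}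
    (h₁ : ∀ q, (e (κ₁ q)).2 = (e q).2 ∧ ((e (κ₁ q)).1 = (e q).1 ↔ P₁ (e q).2))
    (h₂ : ∀ q, (e (κ₂ q)).2 = (e q).2 ∧ ((e (κ₂ q)).1 = (e q).1 ↔ P₂ (e q).2)) (hP : ∀ j, P₁ j ↔ P₂ j) :
    κ₁ = κ₂ := by
  classical
  refine Equiv.ext fun q => e.injective (Prod.ext ?_ (((h₁ q).1).trans ((h₂ q).1).symm))
  by_cases hq : P₁ (e q).2
  · rw [(h₁ q).2.mpr hq, (h₂ q).2.mpr ((hP _).mp hq)]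
  · exact fin_two_eq_of_ne_of_ne (fun h => hq ((h₁ q).2.mp h)) (fun h => hq ((hP _).mpr ((h₂ q).2.mp h)))

/-- Conjugating a transposition through an involution (as composites of words). [folklore] -/
theorem comp_swap_comp_of_apply_apply {κ : Equiv.Perm (Fin D)} (hκκ : ∀ q, κ (κ q) = q) (u : Word N D)
    (a c : Fin D) : (u ∘ ⇑(Equiv.swap a c)) ∘ ⇑κ = (u ∘ ⇑κ) ∘ ⇑(Equiv.swap (κ a) (κ c)) := by
  funext q
  simp only [Function.comp_apply]
  congr 1
  by_cases hqa : q = κ a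
  · rw [hqa, hκκ, Equiv.swap_apply_left, Equiv.swap_apply_left, hκκ]
  by_cases hqc : q = κ c
  · rw [hqc, hκκ, Equiv.swap_apply_right, Equiv.swap_apply_right, hκκ]
  have hqa' : κ q ≠ a := fun h => hqa (by rw [← h, hκκ])
  have hqc' : κ q ≠ c := fun h => hqc (by rw [← h, hκκ])
  rw [Equiv.swap_apply_of_ne_of_ne hqa' hqc', Equiv.swap_apply_of_ne_of_ne hqa hqc]

end DoubleCross

/-! ### §3 The sign law -/

set_option maxHeartbeats 800000 in
/-- **Sign law of the twisted storey design.**  `e` any two-block structure on `[2N]`, `κ = (A B)(C D)` the double cross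
at the slots `h₁ ≠ h₂`, `φ, ψ` the crossed lifts, `ι` a word in which `N` and `N+1` occur exactly at `p_N` and `p_M`; if
`ζ_e(φ∘ι) ≠ 0 ≠ ζ_e((ψ∘ι)∘κ)` then `ζ_e(φ∘ι) · ζ_e((ψ∘ι)∘κ)` is `+1` when `p_N, p_M` are in different blocks and so are
`κ p_N, κ p_M`, and `-1` otherwise. [this node] -/
theorem twist_blockSign_mul {N : ℕ} (e : Fin (N * 2) ≃ Fin 2 × Fin N) {h₁ h₂ : Fin N} (hh : h₁ ≠ h₂)
    {A B C D' : Fin (N * 2)} (hA : e A = (0, h₁)) (hB : e B = (1, h₁)) (hC : e C = (0, h₂)) (hD : e D' = (1, h₂))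
    (κ : Equiv.Perm (Fin (N * 2))) (hκ : κ = Equiv.swap A B * Equiv.swap C D')
    {φ ψ : Fin (N + 2) → Fin N}
    (hφv : ∀ r, ((φ r : Fin N) : ℕ) = if (r : ℕ) < N then (r : ℕ) else (r : ℕ) - N)
    (hψv : ∀ r, ((ψ r : Fin N) : ℕ) = if (r : ℕ) < N then (r : ℕ) else N + 1 - (r : ℕ))
    (ι : Fin (N * 2) → Fin (N + 2)) {pN pM : Fin (N * 2)}
    (hpN : ((ι pN : Fin (N + 2)) : ℕ) = N) (hNu : ∀ q, ((ι q : Fin (N + 2)) : ℕ) = N → q = pN)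
    (hpM : ((ι pM : Fin (N + 2)) : ℕ) = N + 1) (hMu : ∀ q, ((ι q : Fin (N + 2)) : ℕ) = N + 1 → q = pM)
    (hx : wordBlockSign ℂ e (φ ∘ ι) ≠ 0) (hχ : wordBlockSign ℂ e ((ψ ∘ ι) ∘ ⇑κ) ≠ 0) :
    wordBlockSign ℂ e (φ ∘ ι) * wordBlockSign ℂ e ((ψ ∘ ι) ∘ ⇑κ) =
      if (e pN).1 ≠ (e pM).1 ∧ (e (κ pN)).1 ≠ (e (κ pM)).1 then 1 else -1 := by
  classical
  have h01 : (0 : Fin 2) ≠ 1 := by decide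
  have h2N : 2 ≤ N := by by_contra hlt; apply hh; apply Fin.ext; have := h₁.2; have := h₂.2; omega
  -- the double cross `κ`
  have hκcells := doubleCross_apply e h01 hh hA hB hC hD
  have hκspec := doubleCross_spec e h01 hh hA hB hC hD
  have hκκ := doubleCross_apply_apply e h01 hh hA hB hC hD
  have hDC := wordBlockSign_comp_doubleCross e h01 hh hA hB hC hD
  rw [← hκ] at hκcells hκspec hκκ hDC
  have hmoved : ∀ q, κ q ≠ q → (e (κ q)).1 ≠ (e q).1 := fun q hq h =>
    hq (e.injective (Prod.ext h (hκspec q).1))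
  have hslot : ∀ q, κ q ≠ q → (e q).2 = h₁ ∨ (e q).2 = h₂ := by
    intro q hq
    by_contra h'
    exact (mt (hκspec q).2.mpr (hmoved q hq)) ⟨fun h1 => h' (Or.inl h1), fun h2 => h' (Or.inr h2)⟩
  -- the first leg `x` and the second leg `y = x ∘ (p_N p_M)`
  set x : Word N (N * 2) := φ ∘ ι with hxdef
  have hpNM : pN ≠ pM := fun h => by rw [h, hpM] at hpN; omega
  have hrest : ∀ q, q ≠ pN → q ≠ pM → ((ι q : Fin (N + 2)) : ℕ) < N := by
    intro q hqN hqM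
    have h2 := (ι q).2
    by_contra hge
    rcases (by omega : ((ι q : Fin (N + 2)) : ℕ) = N ∨ ((ι q : Fin (N + 2)) : ℕ) = N + 1) with h | h
    exacts [hqN (hNu q h), hqM (hMu q h)]
  have hy : ψ ∘ ι = x ∘ ⇑(Equiv.swap pN pM) := liftPair_second_eq hφv hψv hpN hpM hrest
  rw [hy] at hχ ⊢
  have hxv : ∀ q, ((x q : Fin N) : ℕ) =
      if ((ι q : Fin (N + 2)) : ℕ) < N then ((ι q : Fin (N + 2)) : ℕ) else ((ι q : Fin (N + 2)) : ℕ) - N :=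
    fun q => hφv (ι q)
  have hxN : ((x pN : Fin N) : ℕ) = 0 := by rw [hxv, hpN]; split_ifs <;> omega
  have hxM : ((x pM : Fin N) : ℕ) = 1 := by rw [hxv, hpM]; split_ifs <;> omega
  by_cases hsep : (e pN).1 = (e pM).1
  · -- Case A: `N`, `N+1` in the same block
    rw [if_neg (fun h => h.1 hsep)]
    have hyx := wordBlockSign_comp_swap ℂ e hpNM hsep x
    have hy0 : wordBlockSign ℂ e (x ∘ ⇑(Equiv.swap pN pM)) ≠ 0 := by rw [hyx]; exact neg_ne_zero.mpr hx
    rw [hDC _ hy0 hχ, hyx, mul_neg, wordBlockSign_mul_self_of_ne_zero e hx]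
  by_cases hsep' : (e (κ pN)).1 = (e (κ pM)).1
  · -- Case B': separated, but `κ p_N`, `κ p_M` in the same block
    rw [if_neg (fun h => h.2 hsep')]
    have hne : κ pN ≠ κ pM := fun h => hpNM (κ.injective h)
    rw [comp_swap_comp_of_apply_apply hκκ x pN pM, wordBlockSign_comp_swap ℂ e hne hsep' (x ∘ ⇑κ)] at hχ ⊢
    have hxκ0 : wordBlockSign ℂ e (x ∘ ⇑κ) ≠ 0 := fun h => hχ (by rw [h, neg_zero])
    rw [hDC x hx hxκ0, mul_neg, wordBlockSign_mul_self_of_ne_zero e hx]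
  -- Case C: separated twice
  rw [if_pos ⟨hsep, hsep'⟩]
  suffices hζ : wordBlockSign ℂ e ((x ∘ ⇑(Equiv.swap pN pM)) ∘ ⇑κ) = wordBlockSign ℂ e x by
    rw [hζ, wordBlockSign_mul_self_of_ne_zero e hx]
  have htw : κ pN = pN ↔ κ pM = pM := by
    constructor
    · exact fun hN => by_contra fun hM => hsep' (by rw [hN]; exact fin_two_eq_of_ne_of_ne hsep (hmoved pM hM))
    · exact fun hM => by_contra fun hN =>
        hsep' (by rw [hM]; exact fin_two_eq_of_ne_of_ne (hmoved pN hN) (Ne.symm hsep))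
  by_cases hfix : κ pN = pN
  · -- `p_N`, `p_M` untouched by `κ`: the cells of `0 = φ(N)` opposite `p_M` and of `1 = φ(N+1)` opposite `p_N` are crossed
    have hfixM : κ pM = pM := htw.mp hfix
    have hslotN : (e pN).2 ≠ h₁ ∧ (e pN).2 ≠ h₂ := (hκspec pN).2.mp (by rw [hfix])
    have hslotM : (e pM).2 ≠ h₁ ∧ (e pM).2 ≠ h₂ := (hκspec pM).2.mp (by rw [hfixM])
    -- the cell `I` of block `e(p_M).1` carrying the `x`-letter `0`
    obtain ⟨jI, hjI⟩ := (bijective_of_wordBlockSign_ne_zero e hx (e pM).1).2 ⟨0, by omega⟩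
    obtain ⟨I, hIe, hxI⟩ : ∃ I : Fin (N * 2), e I = ((e pM).1, jI) ∧ ((x I : Fin N) : ℕ) = 0 := by
      refine ⟨e.symm ((e pM).1, jI), e.apply_symm_apply _, ?_⟩
      have h' : x (e.symm ((e pM).1, jI)) = ⟨0, by omega⟩ := hjI
      rw [h']
    have hIN : I ≠ pN := fun h => hsep (by rw [← h, hIe])
    have hI0 : ((ι I : Fin (N + 2)) : ℕ) = 0 := by
      rcases (liftφ_val hφv h2N (ι I)).1.mp hxI with h | h; exacts [h, absurd (hNu I h) hIN]
    have hIM : I ≠ pM := fun h => by rw [h, hpM] at hI0; omega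
    have hItw : κ I ≠ I := by
      intro hfI
      apply hIM
      refine eq_of_wordBlockSign_ne_zero e hχ (by rw [hIe]) (Fin.ext ?_)
      show ((x (Equiv.swap pN pM (κ I)) : Fin N) : ℕ) = ((x (Equiv.swap pN pM (κ pM)) : Fin N) : ℕ)
      rw [hfI, hfixM, Equiv.swap_apply_of_ne_of_ne hIN hIM, Equiv.swap_apply_right, hxI, hxN]
    have hjI12 : jI = h₁ ∨ jI = h₂ := by have := hslot I hItw; rwa [hIe] at this
    -- the cell `O` of block `e(p_N).1` carrying the `x`-letter `1`
    obtain ⟨jO, hjO⟩ := (bijective_of_wordBlockSign_ne_zero e hx (e pN).1).2 ⟨1, by omega⟩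
    obtain ⟨O, hOe, hxO⟩ : ∃ O : Fin (N * 2), e O = ((e pN).1, jO) ∧ ((x O : Fin N) : ℕ) = 1 := by
      refine ⟨e.symm ((e pN).1, jO), e.apply_symm_apply _, ?_⟩
      have h' : x (e.symm ((e pN).1, jO)) = ⟨1, by omega⟩ := hjO
      rw [h']
    have hOM : O ≠ pM := fun h => hsep (by rw [← h, hOe])
    have hO1 : ((ι O : Fin (N + 2)) : ℕ) = 1 := by
      rcases (liftφ_val hφv h2N (ι O)).2.mp hxO with h | h; exacts [h, absurd (hMu O h) hOM]
    have hON : O ≠ pN := fun h => by rw [h, hpN] at hO1; omega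
    have hOtw : κ O ≠ O := by
      intro hfO
      apply hON
      refine eq_of_wordBlockSign_ne_zero e hχ (by rw [hOe]) (Fin.ext ?_)
      show ((x (Equiv.swap pN pM (κ O)) : Fin N) : ℕ) = ((x (Equiv.swap pN pM (κ pN)) : Fin N) : ℕ)
      rw [hfO, hfix, Equiv.swap_apply_of_ne_of_ne hON hOM, Equiv.swap_apply_left, hxO, hxM]
    have hjO12 : jO = h₁ ∨ jO = h₂ := by have := hslot O hOtw; rwa [hOe] at this
    have hxNI : x pN = x I := Fin.ext (by rw [hxN, hxI])
    have hxMO : x pM = x O := Fin.ext (by rw [hxM, hxO])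
    have hbb' : (e pM).1 ≠ (e pN).1 := Ne.symm hsep
    by_cases hjj : jO = jI
    · -- vertical crossed pair `I`, `O`
      obtain ⟨s', hss', hsl⟩ : ∃ s' : Fin N, jI ≠ s' ∧ ∀ j : Fin N, (j ≠ h₁ ∧ j ≠ h₂) ↔ (j ≠ jI ∧ j ≠ s') := by
        rcases hjI12 with h | h
        · exact ⟨h₂, by rw [h]; exact hh, fun j => by rw [h]⟩
        · exact ⟨h₁, by rw [h]; exact hh.symm, fun j => by rw [h, and_comm]⟩
      obtain ⟨C₀, hC₀⟩ : ∃ q : Fin (N * 2), e q = ((e pM).1, s') := ⟨e.symm _, e.apply_symm_apply _⟩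
      obtain ⟨D₀, hD₀⟩ : ∃ q : Fin (N * 2), e q = ((e pN).1, s') := ⟨e.symm _, e.apply_symm_apply _⟩
      have hOe' : e O = ((e pN).1, jI) := by rw [hOe, hjj]
      have hκ₀ : κ = Equiv.swap I O * Equiv.swap C₀ D₀ :=
        perm_eq_of_blockSpec e hκspec (doubleCross_spec e hbb' hss' hIe hOe' hC₀ hD₀) hsl
      obtain ⟨hκI, hκO, -, -, hκ₀q⟩ := doubleCross_apply e hbb' hss' hIe hOe' hC₀ hD₀
      rw [← hκ₀] at hκI hκO hκ₀q
      refine twist_vertPair_eq e hbb' hss' hIe hOe' hC₀ hD₀ hx hχ (P := pN) (M' := pM) rfl rfl hpNM hON.symm hIM.symm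
        hxNI hxMO ?_ ?_ ?_ ?_ ?_
      · intro q hqN hqM hqI hqO hqC hqD
        show x (Equiv.swap pN pM (κ q)) = x q
        rw [hκ₀q q hqI hqO hqC hqD, Equiv.swap_apply_of_ne_of_ne hqN hqM]
      · show x (Equiv.swap pN pM (κ pN)) = x pM
        rw [hfix, Equiv.swap_apply_left]
      · show x (Equiv.swap pN pM (κ pM)) = x pN
        rw [hfixM, Equiv.swap_apply_right]
      · show x (Equiv.swap pN pM (κ I)) = x O
        rw [hκI, Equiv.swap_apply_of_ne_of_ne hON hOM]
      · show x (Equiv.swap pN pM (κ O)) = x I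
        rw [hκO, Equiv.swap_apply_of_ne_of_ne hIN hIM]
    · -- diagonal crossed pair `I`, `O`
      have hss' : jI ≠ jO := Ne.symm hjj
      have hsl : ∀ j : Fin N, (j ≠ h₁ ∧ j ≠ h₂) ↔ (j ≠ jI ∧ j ≠ jO) := by
        rcases hjI12 with hI | hI <;> rcases hjO12 with hO | hO
        · exact absurd (hO.trans hI.symm) hjj
        · intro j; rw [hI, hO]
        · intro j; rw [hI, hO, and_comm]
        · exact absurd (hO.trans hI.symm) hjj
      obtain ⟨B₀, hB₀⟩ : ∃ q : Fin (N * 2), e q = ((e pN).1, jI) := ⟨e.symm _, e.apply_symm_apply _⟩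
      obtain ⟨C₀, hC₀⟩ : ∃ q : Fin (N * 2), e q = ((e pM).1, jO) := ⟨e.symm _, e.apply_symm_apply _⟩
      have hκ₀ : κ = Equiv.swap I B₀ * Equiv.swap C₀ O :=
        perm_eq_of_blockSpec e hκspec (doubleCross_spec e hbb' hss' hIe hB₀ hC₀ hOe) hsl
      obtain ⟨-, hκB, hκC, -, hκ₀q⟩ := doubleCross_apply e hbb' hss' hIe hB₀ hC₀ hOe
      rw [← hκ₀] at hκB hκC hκ₀q
      have hNB : pN ≠ B₀ := by
        intro h
        have h2 : (e pN).2 = jI := by rw [h, hB₀]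
        rcases hjI12 with hj | hj; exacts [hslotN.1 (h2.trans hj), hslotN.2 (h2.trans hj)]
      have hMC : pM ≠ C₀ := by
        intro h
        have h2 : (e pM).2 = jO := by rw [h, hC₀]
        rcases hjO12 with hj | hj; exacts [hslotM.1 (h2.trans hj), hslotM.2 (h2.trans hj)]
      refine twist_diagPair_eq e hbb' hss' hIe hB₀ hC₀ hOe hx hχ (P := pN) (M' := pM) rfl rfl hpNM hNB hON.symm
        hIM.symm hMC hxNI hxMO ?_ ?_ ?_ ?_ ?_
      · intro q hqN hqM hqI hqB hqC hqO
        show x (Equiv.swap pN pM (κ q)) = x q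
        rw [hκ₀q q hqI hqB hqC hqO, Equiv.swap_apply_of_ne_of_ne hqN hqM]
      · show x (Equiv.swap pN pM (κ pN)) = x pM
        rw [hfix, Equiv.swap_apply_left]
      · show x (Equiv.swap pN pM (κ pM)) = x pN
        rw [hfixM, Equiv.swap_apply_right]
      · show x (Equiv.swap pN pM (κ B₀)) = x I
        rw [hκB, Equiv.swap_apply_of_ne_of_ne hIN hIM]
      · show x (Equiv.swap pN pM (κ C₀)) = x O
        rw [hκC, Equiv.swap_apply_of_ne_of_ne hON hOM]
  · -- `p_N` (hence `p_M`) crossed by `κ`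
    have hfixM : κ pM ≠ pM := fun h => hfix (htw.mpr h)
    have hsN := hslot pN hfix
    have hsM := hslot pM hfixM
    have hbb' : (e pN).1 ≠ (e pM).1 := hsep
    have hpNe : e pN = ((e pN).1, (e pN).2) := rfl
    by_cases hjj : (e pM).2 = (e pN).2
    · -- `p_M = κ p_N`: the twist undoes the exchange
      obtain ⟨s', hss', hsl⟩ : ∃ s' : Fin N, (e pN).2 ≠ s' ∧
          ∀ j : Fin N, (j ≠ h₁ ∧ j ≠ h₂) ↔ (j ≠ (e pN).2 ∧ j ≠ s') := by
        rcases hsN with h | h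
        · exact ⟨h₂, by rw [h]; exact hh, fun j => by rw [h]⟩
        · exact ⟨h₁, by rw [h]; exact hh.symm, fun j => by rw [h, and_comm]⟩
      have hpMe : e pM = ((e pM).1, (e pN).2) := by rw [← hjj]
      obtain ⟨C₀, hC₀⟩ : ∃ q : Fin (N * 2), e q = ((e pN).1, s') := ⟨e.symm _, e.apply_symm_apply _⟩
      obtain ⟨D₀, hD₀⟩ : ∃ q : Fin (N * 2), e q = ((e pM).1, s') := ⟨e.symm _, e.apply_symm_apply _⟩
      have hκ₀ : κ = Equiv.swap pN pM * Equiv.swap C₀ D₀ :=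
        perm_eq_of_blockSpec e hκspec (doubleCross_spec e hbb' hss' hpNe hpMe hC₀ hD₀) hsl
      obtain ⟨hκN, hκM, -, -, hκ₀q⟩ := doubleCross_apply e hbb' hss' hpNe hpMe hC₀ hD₀
      rw [← hκ₀] at hκN hκM hκ₀q
      have heq : (x ∘ ⇑(Equiv.swap pN pM)) ∘ ⇑κ = x := by
        refine word_eq_of_agree_off_cross e hχ hx (p := C₀) (p' := D₀) (by rw [hC₀, hD₀]; exact hbb')
          fun q hqC hqD => ?_
        show x (Equiv.swap pN pM (κ q)) = x q
        by_cases hqN : q = pN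
        · rw [hqN, hκN, Equiv.swap_apply_right]
        by_cases hqM : q = pM
        · rw [hqM, hκM, Equiv.swap_apply_left]
        rw [hκ₀q q hqN hqM hqC hqD, Equiv.swap_apply_of_ne_of_ne hqN hqM]
      rw [heq]
    · -- `p_N`, `p_M` crossed on different slots: diagonal lifted pair
      have hss' : (e pN).2 ≠ (e pM).2 := Ne.symm hjj
      have hsl : ∀ j : Fin N, (j ≠ h₁ ∧ j ≠ h₂) ↔ (j ≠ (e pN).2 ∧ j ≠ (e pM).2) := by
        rcases hsN with hI | hI <;> rcases hsM with hO | hO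
        · exact absurd (hO.trans hI.symm) hjj
        · intro j; rw [hI, hO]
        · intro j; rw [hI, hO, and_comm]
        · exact absurd (hO.trans hI.symm) hjj
      have hpMe : e pM = ((e pM).1, (e pM).2) := rfl
      obtain ⟨B₀, hB₀⟩ : ∃ q : Fin (N * 2), e q = ((e pM).1, (e pN).2) := ⟨e.symm _, e.apply_symm_apply _⟩
      obtain ⟨C₀, hC₀⟩ : ∃ q : Fin (N * 2), e q = ((e pN).1, (e pM).2) := ⟨e.symm _, e.apply_symm_apply _⟩
      have hκ₀ : κ = Equiv.swap pN B₀ * Equiv.swap C₀ pM :=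
        perm_eq_of_blockSpec e hκspec (doubleCross_spec e hbb' hss' hpNe hB₀ hC₀ hpMe) hsl
      obtain ⟨-, hκB, hκC, -, hκ₀q⟩ := doubleCross_apply e hbb' hss' hpNe hB₀ hC₀ hpMe
      rw [← hκ₀] at hκB hκC hκ₀q
      refine twist_diag_eq e hbb' hss' hpNe hB₀ hC₀ hpMe hx hχ ?_ ?_ ?_
      · intro q hqN hqB hqC hqM
        show x (Equiv.swap pN pM (κ q)) = x q
        rw [hκ₀q q hqN hqB hqC hqM, Equiv.swap_apply_of_ne_of_ne hqN hqM]
      · show x (Equiv.swap pN pM (κ B₀)) = x pM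
        rw [hκB, Equiv.swap_apply_left]
      · show x (Equiv.swap pN pM (κ C₀)) = x pN
        rw [hκC, Equiv.swap_apply_right]

end Summit.MatrixMultiplication.MatrixMultiplication.Theorems.ObstructionCalculus

end
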